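import Mathlib.Algebra.MvPolynomial.Variables
import Literature.Computability.AlgebraicComplexity.ArithCircuitProofs
import HarnessLib

/-!
# Arithmetic circuits: a fan-in-two circuit of size `s` reads at most `2s + 1` variables

Companion of `ArithCircuit.lean` / `ArithCircuitProofs.lean` (Bürgisser's model, [Burgisser2000,
Def. 2.1]: straight-line programs whose gates are weighted sums / products of operands — input
variables, constants, earlier gates — `size` = number of gates, variables and constants free).
This file records the elementary support bound behind "input gates are variables" vs. "input
gates are affine forms" comparisons (used by `BDGIL24AffineInputsVP.lean`):

* `Operand.varSet`, `Gate.varSet`, `gatesVarSet`, `varSet` — the finite set of input variables an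
  operand / a gate / a gate list / a circuit READS;
* `vars_eval_subset` — the polynomial computed by a circuit involves only variables it reads;
* `card_varSet_le` — a fan-in-two circuit with `s` gates reads at most `2s + 1` variables
  (two operands per gate, one output operand);
* `card_vars_le_two_mul_complexity_add_one` — hence **`|vars f| ≤ 2 L(f) + 1`** for every polynomial.

Honest framing: circuit bookkeeping; nothing here bears on `VP ≠ VNP`. (Summit-side twin of the
last item, not importable here: `PerDivisionHardNegative.card_vars_le_complexity` in
`Summits/ValiantsHypothesis/ValiantsHypothesis/Theorems/PerDivisionHard/Negative/VarsCounting.lean`.)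

## References
* [Burgisser2000] P. Bürgisser, *Completeness and Reduction in Algebraic Complexity Theory*,
  Def. 2.1 (computation sequences; size), Rem. 2.2.
-/

noncomputable section

open MvPolynomial

namespace Literature.Computability.AlgebraicComplexity

universe u v

namespace ArithCircuit

variable {k : Type u} {σ : Type v}

/-! ### The variables read by a circuit -/

/-- The input variables read by an operand: `{i}` for `var i`, none for constants and gate
references. [cite: Burgisser2000, Def. 2.1] -/
def Operand.varSet : Operand k σ → Finset σ
  | .var i => {i}
  | .const _ => ∅
  | .gate _ => ∅

/-- An operand reads at most one variable. [cite: Burgisser2000, Def. 2.1] -/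
theorem Operand.card_varSet_le (u : Operand k σ) : u.varSet.card ≤ 1 := by
  cases u <;> simp [Operand.varSet]

variable [DecidableEq σ]

/-- The input variables read by a list of operands. [cite: Burgisser2000, Def. 2.1] -/
def operandsVarSet (us : List (Operand k σ)) : Finset σ :=
  us.foldr (fun u S => u.varSet ∪ S) ∅

/-- The input variables read by a gate (through its operands). [cite: Burgisser2000, Def. 2.1] -/
def Gate.varSet (g : Gate k σ) : Finset σ :=
  operandsVarSet g.args

/-- The input variables read by a list of gates. [cite: Burgisser2000, Def. 2.1] -/
def gatesVarSet (gs : List (Gate k σ)) : Finset σ :=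
  gs.foldr (fun g S => g.varSet ∪ S) ∅

/-- The input variables read by a circuit: those of its gates and of its output operand.
[cite: Burgisser2000, Def. 2.1] -/
def varSet (P : ArithCircuit k σ) : Finset σ :=
  gatesVarSet P.gates ∪ P.output.varSet

/-! ### Counting: at most one variable per operand, two per fan-in-two gate -/

/-- A list of operands reads at most as many variables as it has entries. [cite: Burgisser2000, Def. 2.1] -/
theorem card_operandsVarSet_le (us : List (Operand k σ)) : (operandsVarSet us).card ≤ us.length := by
  induction us with
  | nil => simp [operandsVarSet]
  | cons u us ih =>
    rw [operandsVarSet, List.foldr_cons, List.length_cons]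
    refine (Finset.card_union_le _ _).trans ?_
    have h1 := Operand.card_varSet_le (k := k) u
    have h2 : (List.foldr (fun u S => Operand.varSet u ∪ S) ∅ us).card ≤ us.length := ih
    omega

/-- A gate reads at most `fanIn` variables. [cite: Burgisser2000, Def. 2.1] -/
theorem Gate.card_varSet_le (g : Gate k σ) : g.varSet.card ≤ g.fanIn :=
  card_operandsVarSet_le g.args

/-- A list of gates of fan-in `≤ 2` reads at most `2 ·` (number of gates) variables. [cite: Burgisser2000, Def. 2.1] -/
theorem card_gatesVarSet_le (gs : List (Gate k σ)) (h : ∀ g ∈ gs, g.fanIn ≤ 2) :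
    (gatesVarSet gs).card ≤ 2 * gs.length := by
  induction gs with
  | nil => simp [gatesVarSet]
  | cons g gs ih =>
    rw [gatesVarSet, List.foldr_cons, List.length_cons]
    refine (Finset.card_union_le _ _).trans ?_
    have h1 := (Gate.card_varSet_le (k := k) g).trans (h g (List.mem_cons_self))
    have h2 : (List.foldr (fun g S => Gate.varSet g ∪ S) ∅ gs).card ≤ 2 * gs.length :=
      ih fun g' hg' => h g' (List.mem_cons_of_mem _ hg')
    omega

/-- **A fan-in-two circuit of size `s` reads at most `2s + 1` variables** (two per gate, one for
the output operand). [cite: Burgisser2000, Def. 2.1] -/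
theorem card_varSet_le (P : ArithCircuit k σ) (h : P.IsFanInTwo) : P.varSet.card ≤ 2 * P.size + 1 := by
  rw [varSet, size]
  refine (Finset.card_union_le _ _).trans ?_
  have h1 := card_gatesVarSet_le P.gates h
  have h2 := Operand.card_varSet_le (k := k) P.output
  omega

/-! ### Soundness: the computed polynomial involves only the variables read -/

section Vars

variable [CommSemiring k]

omit [DecidableEq σ] in
/-- `vars (X i) ⊆ {i}` (equality unless the coefficient ring is trivial). [folklore] -/
private theorem vars_X_subset (i : σ) : (X i : MvPolynomial σ k).vars ⊆ {i} := by
  rcases subsingleton_or_nontrivial k with hk | hk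
  · have : (X i : MvPolynomial σ k) = 0 := Subsingleton.elim _ _
    rw [this, vars_0]
    exact Finset.empty_subset _
  · rw [vars_X]

/-- The value of an operand involves only variables of the value list and the operand's own
variable. [cite: Burgisser2000, Def. 2.1] -/
theorem vars_operand_eval_subset (vals : List (MvPolynomial σ k)) (S : Finset σ)
    (h : ∀ v ∈ vals, v.vars ⊆ S) (u : Operand k σ) : (u.eval vals).vars ⊆ S ∪ u.varSet := by
  cases u with
  | var i => exact (vars_X_subset i).trans (by simp [Operand.varSet])
  | const c => simp [Operand.eval, vars_C]
  | gate j =>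
    rw [Operand.eval_gate, List.getD_eq_getElem?_getD]
    cases hj : vals[j]? with
    | none => simp [vars_0]
    | some v =>
      have hv : v ∈ vals := List.mem_of_getElem? hj
      simpa using (h v hv).trans Finset.subset_union_left

/-- The value of a gate involves only variables of the value list and the variables it reads.
[cite: Burgisser2000, Def. 2.1] -/
theorem vars_gate_eval_subset (vals : List (MvPolynomial σ k)) (S : Finset σ)
    (h : ∀ v ∈ vals, v.vars ⊆ S) (g : Gate k σ) : (g.eval vals).vars ⊆ S ∪ g.varSet := by
  cases g with
  | sum args =>
    rw [Gate.eval, Gate.varSet, Gate.args]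
    induction args with
    | nil => simp [vars_0]
    | cons a args ih =>
      rw [List.map_cons, List.sum_cons, List.map_cons, operandsVarSet, List.foldr_cons]
      refine (vars_add_subset _ _).trans (Finset.union_subset ?_ ?_)
      · rw [smul_eq_C_mul]
        refine (vars_mul _ _).trans ?_
        rw [vars_C, Finset.empty_union]
        exact (vars_operand_eval_subset vals S h a.2).trans (by
          intro x hx
          simp only [Finset.mem_union] at hx ⊢
          tauto)
      · refine ih.trans ?_
        intro x hx
        simp only [Finset.mem_union, operandsVarSet] at hx ⊢
        tauto
  | prod args =>
    rw [Gate.eval, Gate.varSet, Gate.args]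
    induction args with
    | nil => simp [vars_def, degrees_one]
    | cons u args ih =>
      rw [List.map_cons, List.prod_cons, operandsVarSet, List.foldr_cons]
      refine (vars_mul _ _).trans (Finset.union_subset ?_ ?_)
      · exact (vars_operand_eval_subset vals S h u).trans (by
          intro x hx
          simp only [Finset.mem_union] at hx ⊢
          tauto)
      · refine ih.trans ?_
        intro x hx
        simp only [Finset.mem_union, operandsVarSet] at hx ⊢
        tauto

/-- Every gate value involves only variables read by the gate list. [cite: Burgisser2000, Def. 2.1] -/
theorem vars_subset_of_mem_gateValues (gs : List (Gate k σ)) :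
    ∀ v ∈ gateValues gs, v.vars ⊆ gatesVarSet gs := by
  induction gs using List.reverseRecOn with
  | nil => simp [gateValues]
  | append_singleton gs g ih =>
    intro v hv
    rw [gateValues_append_singleton, List.mem_append, List.mem_singleton] at hv
    have hmono : gatesVarSet gs ⊆ gatesVarSet (gs ++ [g]) ∧ g.varSet ⊆ gatesVarSet (gs ++ [g]) := by
      rw [gatesVarSet, gatesVarSet, List.foldr_append, List.foldr_cons, List.foldr_nil,
        Finset.union_empty]
      clear ih hv
      induction gs with
      | nil => simp
      | cons g' gs ih' =>
        rw [List.foldr_cons, List.foldr_cons]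
        exact ⟨Finset.union_subset_union le_rfl ih'.1, ih'.2.trans Finset.subset_union_right⟩
    rcases hv with hv | rfl
    · exact (ih v hv).trans hmono.1
    · exact (vars_gate_eval_subset _ _ ih g).trans (Finset.union_subset hmono.1 hmono.2)

/-- **The polynomial computed by a circuit involves only the variables the circuit reads.**
[cite: Burgisser2000, Def. 2.1] -/
theorem vars_eval_subset (P : ArithCircuit k σ) : P.eval.vars ⊆ P.varSet := by
  rw [eval, varSet]
  exact vars_operand_eval_subset _ _ (vars_subset_of_mem_gateValues P.gates) P.output

/-- **`|vars f| ≤ 2 L(f) + 1`**: a polynomial of circuit complexity `s` involves at most `2s + 1`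
variables (an optimal fan-in-two circuit reads at most two variables per gate and one at the
output). The same inequality is proved summit-side, with the variable sets produced existentially,
as `Summit.ValiantsHypothesis.Theorems.PerDivisionHardNegative.card_vars_le_complexity`
(`Summits/…/PerDivisionHard/Negative/VarsCounting.lean`, not importable from `Literature/`); this is
its Literature-side form through the explicit `varSet`. [cite: Burgisser2000, Def. 2.1] -/
theorem card_vars_le_two_mul_complexity_add_one (f : MvPolynomial σ k) :
    f.vars.card ≤ 2 * complexity f + 1 := by
  obtain ⟨P, h2, hc, hs⟩ := exists_computes_size_eq_complexity f
  rw [← hs]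
  have hsub : f.vars ⊆ P.varSet := by
    rw [Computes] at hc
    rw [← hc]
    exact vars_eval_subset P
  exact (Finset.card_le_card hsub).trans (card_varSet_le P h2)

end Vars

end ArithCircuit

end Literature.Computability.AlgebraicComplexity
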